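import Mathlib
import Literature.NumberTheory.LFunctions.Zhang2022.Section11XiZeroTrueSize
import Literature.NumberTheory.LFunctions.Zhang2022.Section11SjWindowWeights
import HarnessLib

/-!
# Zhang (2022) §7 p. 33 / §11 p. 64: `|S_j(𝐚₁,𝐚₂)| ≤ C·B₁B₂·𝓛²⁷` for bounded sequences — the
# true-size bound for the arithmetic sums of Proposition 7.1

Topic `Literature/NumberTheory/LFunctions/Zhang2022` (Landau–Siegel audit tree; verdict-neutral).
Y. Zhang, *Discrete mean estimates and the Landau–Siegel zero*, arXiv:2211.02515v1 (2022)
[Zhang2022LandauSiegel], §7 p. 33 (Proposition 7.1: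
`S_j(𝐚₁,𝐚₂) = Σ_dΣ_r |μ(r)|λ₀ⱼ(dr)/(drφ(r))(Σ_m a₁(drm)m^{−(1−β_j)})(Σ_n a₂(drn)ξ₀ⱼ(n;d,r)/n)`)
and §11 p. 64 (tex L3298–L3301, "By (11.3), (8.25) and (8.26)" — the window mean square
`Z22:§11.u019`, typed `Typed.TypedSection11B.Step11u019`, GAP row G-L3t10-1; (8.25)/(8.26) do not
exist in v1) — **an unrefereed manuscript under adjudication; nothing here asserts or denies its
Theorems 1–2.** ZHANG-L discharge lane, WP11.

The tree's `XiZeroMajorant.norm_Sj_le` / `sjPolylog` (`Section7SjPolylog`) bound `S_j` for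
`|a| ≤ 1` by `K·𝓛⁷²` (logarithmic mean of `|ξ₀ⱼ|` of exponent `5`). With the TRUE-SIZE
logarithmic mean `Σ_{n≤X}|ξ₀ⱼ(n;d,r)|/n ≤ K_x·2^{ω(r)}·𝓛⁹` (`Section11XiZeroTrueSize`, exponent `1`)
and the weight sum `Σ_r |μ(r)|Λc(r)2^{ω(r)}/(rφ(r)) ≤ e^{28+14S₀}` (`Section11SjWindowWeights`)
the same skeleton gives, for ARBITRARY sequences bounded by `B₁`, `B₂` (theorems only):

* `norm_Sj_term_le_of_bounds` — one term:
  `≤ (Λc(d)/d)(|μ(r)|Λc(r)/(rφ(r)))·(B₁Σ_m 1/m)·(B₂Σ_n |ξ₀ⱼ(n;d,r)|/n)`;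
* `norm_Sj_le_of_bounds` — **`|S_j(𝐚₁,𝐚₂)| ≤ C_S·B₁B₂·𝓛²⁷`** for `D ≥ ⌈exp(5|c′|π+3)⌉`
  (`𝓛 = log D ≥ 3`), every `j`, with the absolute constant
  `C_S = 4e^{4+S₀}·e^{16+7S₀}·e^{28+14S₀}·3e^{4+1134π+(12+56S₃)+7(2+S₃)S₄}`
  (`𝓛⁹` each from `Σ_d Λc(d)/d`, `Σ_m 1/m` and the true-size `ξ₀ⱼ`-mean; `N = ⌈PT⁻²⌉ ≤ 2P`,
  `log N ≤ 2𝓛⁹`).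

Use (`Section11Step11u019Holds`): with the SHARP (11.3) `|f̃ − g̃₁| ≤ 1000𝓛⁻²⁴`
(`Section11WindowCoefficientsSharp`, zl-libB-p1) the window sequences have `B₁ = B₂ = 1000𝓛⁻²⁴`, so
`𝓛⁹|S_j(𝐚,𝐚̄)| ≤ 10⁶C_S·𝓛⁻¹² → 0`, which is the hypothesis of
`Section11WindowMeanSquare.step11u019_of_sjWindow_eventually` (zl-libB-p3). No window structure
and no short-interval input is needed. No statement about Landau–Siegel zeros is made or implied.

## References

* Y. Zhang, arXiv:2211.02515v1 (2022), §7 Prop. 7.1 p. 33; §11 p. 64.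
  [cite: Zhang2022LandauSiegel, §7 Prop. 7.1 p.33; §11 p.64]
* R. R. Hall, G. Tenenbaum, *Divisors* (CUP 1988), (0.4). [cite: HallTenenbaum1988, (0.4)]
-/

noncomputable section

open Finset Real ArithmeticFunction

namespace Literature.NumberTheory.LFunctions.Zhang2022.XiZeroMajorant

open MeanSquareMajorant

variable (c' : ℝ) (D : ℕ)

/-! ### One term of `S_j` with the bounds `B₁, B₂` and the weight `|μ(r)|/φ(r)` kept -/

/-- **One term of `S_j`, bounded sequences**: for `d, r ≠ 0` and `|a₁| ≤ B₁`, `|a₂| ≤ B₂`,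
`‖ |μ(r)|λ₀ⱼ(dr)/(drφ(r)) · (Σ_m a₁(drm)m^{−(1−β_j)}) · (Σ_n a₂(drn)ξ₀ⱼ(n;d,r)/n) ‖`
`≤ (Λc(d)/d)·(|μ(r)|Λc(r)/(rφ(r)))·(B₁Σ_m 1/m)·(B₂Σ_n |ξ₀ⱼ(n;d,r)|/n)` (sums over `m, n < N`).
[cite: Zhang2022LandauSiegel, §7 Prop. 7.1 p.33] -/
theorem norm_Sj_term_le_of_bounds {d r : ℕ} (hd : d ≠ 0) (hr : r ≠ 0) (j N : ℕ) {a₁ a₂ : ℕ → ℂ}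
    {B₁ B₂ : ℝ} (ha₁ : ∀ n, ‖a₁ n‖ ≤ B₁) (ha₂ : ∀ n, ‖a₂ n‖ ≤ B₂) :
    ‖((ArithmeticFunction.moebius r).natAbs : ℂ) * Skeleton.lamZero c' D j (d * r) /
          ((d * r : ℕ) * (Nat.totient r : ℂ)) *
        (∑ m ∈ Ico 1 N, a₁ (d * r * m) / (m : ℂ) ^ (1 - Skeleton.betaJ c' D j)) *
        (∑ n ∈ Ico 1 N, a₂ (d * r * n) * Skeleton.xiZero c' D j n d r / (n : ℂ))‖ ≤
      (LamC d / d) * (((ArithmeticFunction.moebius r).natAbs : ℝ) * LamC r /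
          ((r : ℝ) * (Nat.totient r : ℝ))) * (B₁ * ∑ m ∈ Ico 1 N, (1 : ℝ) / m) *
        (B₂ * ∑ n ∈ Ico 1 N, ‖Skeleton.xiZero c' D j n d r‖ / n) := by
  have hdr : d * r ≠ 0 := mul_ne_zero hd hr
  have hdpos : (0 : ℝ) < d := by exact_mod_cast Nat.pos_of_ne_zero hd
  have hrpos : (0 : ℝ) < r := by exact_mod_cast Nat.pos_of_ne_zero hr
  have hφpos : (0 : ℝ) < Nat.totient r := by
    exact_mod_cast Nat.totient_pos.mpr (Nat.pos_of_ne_zero hr)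
  have hB₁ : 0 ≤ B₁ := le_trans (norm_nonneg _) (ha₁ 0)
  have hB₂ : 0 ≤ B₂ := le_trans (norm_nonneg _) (ha₂ 0)
  -- the weight
  have hw : ‖((ArithmeticFunction.moebius r).natAbs : ℂ) * Skeleton.lamZero c' D j (d * r) /
      ((d * r : ℕ) * (Nat.totient r : ℂ))‖ ≤
      (LamC d / d) * (((ArithmeticFunction.moebius r).natAbs : ℝ) * LamC r /
        ((r : ℝ) * (Nat.totient r : ℝ))) := by
    rw [norm_div, norm_mul, norm_mul, Complex.norm_natCast, Complex.norm_natCast,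
      Complex.norm_natCast]
    push_cast
    have hden : (0 : ℝ) < (d : ℝ) * r * Nat.totient r := by positivity
    have hlam : ‖Skeleton.lamZero c' D j (d * r)‖ ≤ LamC d * LamC r :=
      (norm_lamZero_le_LamC c' D hdr j).trans (LamC_mul_le hd hr)
    have hμ0 : (0 : ℝ) ≤ ((ArithmeticFunction.moebius r).natAbs : ℝ) := Nat.cast_nonneg _
    have hnum : ((ArithmeticFunction.moebius r).natAbs : ℝ) * ‖Skeleton.lamZero c' D j (d * r)‖ ≤
        ((ArithmeticFunction.moebius r).natAbs : ℝ) * (LamC d * LamC r) :=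
      mul_le_mul_of_nonneg_left hlam hμ0
    calc ((ArithmeticFunction.moebius r).natAbs : ℝ) * ‖Skeleton.lamZero c' D j (d * r)‖ /
          ((d : ℝ) * r * Nat.totient r)
        ≤ ((ArithmeticFunction.moebius r).natAbs : ℝ) * (LamC d * LamC r) /
            ((d : ℝ) * r * Nat.totient r) := div_le_div_of_nonneg_right hnum hden.le
      _ = (LamC d / d) * (((ArithmeticFunction.moebius r).natAbs : ℝ) * LamC r /
            ((r : ℝ) * (Nat.totient r : ℝ))) := by
          field_simp
  -- the `m`-sum
  have hm : ‖∑ m ∈ Ico 1 N, a₁ (d * r * m) / (m : ℂ) ^ (1 - Skeleton.betaJ c' D j)‖ ≤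
      B₁ * ∑ m ∈ Ico 1 N, (1 : ℝ) / m := by
    rw [mul_sum]
    refine (norm_sum_le _ _).trans (sum_le_sum fun m hm => ?_)
    have hmpos : 0 < m := (mem_Ico.mp hm).1
    rw [norm_div, Complex.norm_natCast_cpow_of_pos hmpos, one_sub_betaJ_re, Real.rpow_one,
      mul_one_div]
    exact div_le_div_of_nonneg_right (ha₁ _) (Nat.cast_nonneg m)
  -- the `n`-sum
  have hn : ‖∑ n ∈ Ico 1 N, a₂ (d * r * n) * Skeleton.xiZero c' D j n d r / (n : ℂ)‖ ≤
      B₂ * ∑ n ∈ Ico 1 N, ‖Skeleton.xiZero c' D j n d r‖ / n := by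
    rw [mul_sum]
    refine (norm_sum_le _ _).trans (sum_le_sum fun n _ => ?_)
    rw [norm_div, norm_mul, Complex.norm_natCast, ← mul_div_assoc]
    refine div_le_div_of_nonneg_right ?_ (Nat.cast_nonneg n)
    exact mul_le_mul_of_nonneg_right (ha₂ _) (norm_nonneg _)
  have hw0 : 0 ≤ (LamC d / d) * (((ArithmeticFunction.moebius r).natAbs : ℝ) * LamC r /
      ((r : ℝ) * (Nat.totient r : ℝ))) :=
    mul_nonneg (div_nonneg (LamC_nonneg d) hdpos.le)
      (div_nonneg (mul_nonneg (Nat.cast_nonneg _) (LamC_nonneg r)) (by positivity))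
  have hm0 : 0 ≤ B₁ * ∑ m ∈ Ico 1 N, (1 : ℝ) / m :=
    mul_nonneg hB₁ (sum_nonneg fun m _ => by positivity)
  rw [norm_mul, norm_mul]
  exact mul_le_mul (mul_le_mul hw hm (norm_nonneg _) hw0) hn (norm_nonneg _)
    (mul_nonneg hw0 hm0)

/-! ### `|S_j(𝐚₁,𝐚₂)| ≤ C_S·B₁B₂·𝓛²⁷` -/

/-- **The true-size bound for `S_j`.** For `D ≥ ⌈exp(5|c′|π+3)⌉` (so `𝓛 = log D ≥ 3` and the
shifts satisfy `|b₁|+|b₂|+|b₃| ≤ 9π𝓛⁻⁹`), every `j` and all sequences `𝐚₁, 𝐚₂` with `|a₁| ≤ B₁`,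
`|a₂| ≤ B₂`: **`|S_j(𝐚₁,𝐚₂)| ≤ C_S·B₁B₂·𝓛²⁷`**,
`C_S = 4e^{4+S₀}e^{16+7S₀}e^{28+14S₀}·3e^{4+1134π+(12+56S₃)+7(2+S₃)S₄}` — one `𝓛⁹` each from
`Σ_{d<N}Λc(d)/d`, `Σ_{m<N}1/m` (`N = ⌈PT⁻²⌉`, `log N ≤ 2𝓛⁹`) and the true-size logarithmic mean
of `ξ₀ⱼ` (`sum_norm_xiZero_div_le_ell9`), the factor `2^{ω(r)}` of the latter being absorbed by
`Σ_r |μ(r)|Λc(r)2^{ω(r)}/(rφ(r)) ≤ e^{28+14S₀}` (`sum_moebius_LamC_two_pow_div_le`).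
[cite: Zhang2022LandauSiegel, §7 Prop. 7.1 p.33; §11 p.64] -/
theorem norm_Sj_le_of_bounds {c' : ℝ} {D : ℕ} (hD : ⌈Real.exp (5 * |c'| * π + 3)⌉₊ ≤ D)
    (j : ℕ) {a₁ a₂ : ℕ → ℂ} {B₁ B₂ : ℝ} (ha₁ : ∀ n, ‖a₁ n‖ ≤ B₁) (ha₂ : ∀ n, ‖a₂ n‖ ≤ B₂) :
    ‖Skeleton.Sj c' D j a₁ a₂‖ ≤
      (4 * Real.exp (4 + LogEulerProduct.tailConst 0) *
          Real.exp (16 + 7 * LogEulerProduct.tailConst 0) *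
          Real.exp (28 + 14 * LogEulerProduct.tailConst 0) *
          (3 * Real.exp (4 + 1134 * π + (12 + 56 * LogEulerProduct.tailConst 3) +
            7 * (2 + LogEulerProduct.tailConst 3) * LogEulerProduct.tailConst 4))) *
        B₁ * B₂ * Skeleton.ell D ^ 27 := by
  have hB₁ : 0 ≤ B₁ := le_trans (norm_nonneg _) (ha₁ 0)
  have hB₂ : 0 ≤ B₂ := le_trans (norm_nonneg _) (ha₂ 0)
  -- the constants
  set EH : ℝ := Real.exp (4 + LogEulerProduct.tailConst 0) with hEH
  set EΛ : ℝ := Real.exp (16 + 7 * LogEulerProduct.tailConst 0) with hEΛ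
  set ER : ℝ := Real.exp (28 + 14 * LogEulerProduct.tailConst 0) with hER
  set KX : ℝ := 3 * Real.exp (4 + 1134 * π + (12 + 56 * LogEulerProduct.tailConst 3) +
    7 * (2 + LogEulerProduct.tailConst 3) * LogEulerProduct.tailConst 4) with hKX
  have hEH0 : 0 < EH := Real.exp_pos _
  have hEΛ0 : 0 < EΛ := Real.exp_pos _
  have hER0 : 0 < ER := Real.exp_pos _
  have hKX0 : 0 < KX := by rw [hKX]; positivity
  -- `𝓛 ≥ 3`
  obtain ⟨hL3, -⟩ := three_le_ell_and_Bsum_le hD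
  set ℓ := Skeleton.ell D with hℓ
  have hℓ1 : 1 ≤ ℓ := by linarith
  -- `N = ⌈PT⁻²⌉`, `2 ≤ N ≤ 2P`, `log N ≤ 2𝓛⁹`
  have hPT : Skeleton.bigP D / Skeleton.bigT D ^ 2 =
      Real.exp (ℓ ^ 9 - 2 * ℓ ^ (1.1 : ℝ)) := by
    rw [Skeleton.bigP, Skeleton.bigT, ← Real.exp_nat_mul, ← Real.exp_sub]
    push_cast
    rfl
  set N : ℕ := Skeleton.Nsupp D with hNdef
  have hl11 : ℓ ^ (1.1 : ℝ) ≤ ℓ ^ 2 := by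
    calc ℓ ^ (1.1 : ℝ) ≤ ℓ ^ (2 : ℝ) := Real.rpow_le_rpow_of_exponent_le hℓ1 (by norm_num)
      _ = ℓ ^ 2 := Real.rpow_two ℓ
  have hl9 : 2 * ℓ ^ 2 + 1 ≤ ℓ ^ 9 := by
    have h7 : (2187 : ℝ) ≤ ℓ ^ 7 := by
      calc (2187 : ℝ) = 3 ^ 7 := by norm_num
        _ ≤ ℓ ^ 7 := pow_le_pow_left₀ (by norm_num) hL3 7
    have hl2 : 1 ≤ ℓ ^ 2 := one_le_pow₀ hℓ1
    nlinarith
  have hN2r : (2 : ℝ) ≤ N := by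
    have h1 : Real.exp 1 ≤ Skeleton.bigP D / Skeleton.bigT D ^ 2 := by
      rw [hPT]; exact Real.exp_le_exp.mpr (by linarith)
    have h2 : (2 : ℝ) ≤ Real.exp 1 := by
      have := Real.add_one_le_exp (1 : ℝ); linarith
    calc (2 : ℝ) ≤ Skeleton.bigP D / Skeleton.bigT D ^ 2 := h2.trans h1
      _ ≤ N := by rw [hNdef, Skeleton.Nsupp]; exact Nat.le_ceil _
  have hN2 : 2 ≤ N := by exact_mod_cast hN2r
  have hNpos : (0 : ℝ) < N := by linarith
  have hP1 : 1 ≤ Skeleton.bigP D := by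
    rw [Skeleton.bigP]; exact Real.one_le_exp (by positivity)
  have hT1 : 1 ≤ Skeleton.bigT D := by
    rw [Skeleton.bigT]; exact Real.one_le_exp (by positivity)
  have hNle : (N : ℝ) ≤ 2 * Skeleton.bigP D := by
    have h1 : (N : ℝ) < Skeleton.bigP D / Skeleton.bigT D ^ 2 + 1 := by
      rw [hNdef, Skeleton.Nsupp]; exact Nat.ceil_lt_add_one (by positivity)
    have h2 : Skeleton.bigP D / Skeleton.bigT D ^ 2 ≤ Skeleton.bigP D := by
      refine div_le_self (by linarith) (one_le_pow₀ hT1)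
    linarith
  have hN4P : (N : ℝ) ≤ 4 * Skeleton.bigP D := by linarith
  have hlogN : Real.log N ≤ 2 * ℓ ^ 9 := by
    calc Real.log N ≤ Real.log (2 * Skeleton.bigP D) := Real.log_le_log hNpos hNle
      _ = Real.log 2 + ℓ ^ 9 := by
          rw [Real.log_mul (by norm_num) (by linarith), Skeleton.bigP, Real.log_exp]
      _ ≤ 1 + ℓ ^ 9 := by
          have := Real.log_le_sub_one_of_pos (show (0:ℝ) < 2 by norm_num); linarith
      _ ≤ 2 * ℓ ^ 9 := by linarith [one_le_pow₀ (n := 9) hℓ1]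
  have hlogN0 : 0 ≤ Real.log N := Real.log_nonneg (by linarith)
  -- the three mean values
  have hsubN : Ico 1 N ⊆ Icc 1 N := fun n hn => by
    rw [mem_Ico] at hn; rw [mem_Icc]; omega
  have hΛ : ∑ d ∈ Ico 1 N, LamC d / d ≤ EΛ * (2 * ℓ ^ 9) := by
    have h := sum_LamC_div_le hN2
    simp only [Nat.cast_one, mul_one, zero_mul, add_zero, pow_one] at h
    have e : (4 : ℝ) + 12 + 7 * LogEulerProduct.tailConst 0 = 16 + 7 * LogEulerProduct.tailConst 0 := by
      ring
    rw [e, ← hEΛ] at h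
    refine (sum_le_sum_of_subset_of_nonneg hsubN fun d _ _ =>
      div_nonneg (LamC_nonneg d) (Nat.cast_nonneg d)).trans (h.trans ?_)
    exact mul_le_mul_of_nonneg_left hlogN hEΛ0.le
  have hHm : ∑ m ∈ Ico 1 N, (1 : ℝ) / m ≤ EH * (2 * ℓ ^ 9) := by
    have h := sum_inv_le hN2
    simp only [Nat.cast_one, mul_one, zero_mul, add_zero, one_mul, pow_one] at h
    rw [← hEH] at h
    refine (sum_le_sum_of_subset_of_nonneg hsubN fun m _ _ => by positivity).trans (h.trans ?_)
    exact mul_le_mul_of_nonneg_left hlogN hEH0.le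
  have hΞ : ∀ {d r : ℕ}, d ≠ 0 → r ≠ 0 →
      ∑ n ∈ Ico 1 N, ‖Skeleton.xiZero c' D j n d r‖ / n ≤
        KX * (2 : ℝ) ^ r.primeFactors.card * ℓ ^ 9 := by
    intro d r hd hr
    refine (sum_le_sum_of_subset_of_nonneg hsubN fun n _ _ =>
      div_nonneg (norm_nonneg _) (Nat.cast_nonneg n)).trans ?_
    have h := sum_norm_xiZero_div_le_ell9 hD j hd hr hN2 hN4P
    rw [← hKX] at h
    exact h
  -- the weight sum with `2^{ω(r)}`
  have hR : ∑ r ∈ Ico 1 N, ((ArithmeticFunction.moebius r).natAbs : ℝ) * LamC r *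
      (2 : ℝ) ^ r.primeFactors.card / ((r : ℝ) * (Nat.totient r : ℝ)) ≤ ER := by
    refine (sum_le_sum_of_subset_of_nonneg hsubN fun r _ _ => ?_).trans
      (sum_moebius_LamC_two_pow_div_le N)
    exact div_nonneg (mul_nonneg (mul_nonneg (Nat.cast_nonneg _) (LamC_nonneg r))
      (by positivity)) (by positivity)
  -- termwise
  set H : ℝ := EH * (2 * ℓ ^ 9) with hH
  have hH0 : 0 ≤ H := by positivity
  rw [Skeleton.Sj, ← hNdef]
  calc ‖∑ d ∈ Ico 1 N, ∑ r ∈ Ico 1 N,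
          ((ArithmeticFunction.moebius r).natAbs : ℂ) * Skeleton.lamZero c' D j (d * r) /
              ((d * r : ℕ) * (Nat.totient r : ℂ)) *
            (∑ m ∈ Ico 1 N, a₁ (d * r * m) / (m : ℂ) ^ (1 - Skeleton.betaJ c' D j)) *
            (∑ n ∈ Ico 1 N, a₂ (d * r * n) * Skeleton.xiZero c' D j n d r / (n : ℂ))‖
      ≤ ∑ d ∈ Ico 1 N, ∑ r ∈ Ico 1 N,
          (LamC d / d) * (((ArithmeticFunction.moebius r).natAbs : ℝ) * LamC r /
              ((r : ℝ) * (Nat.totient r : ℝ))) * (B₁ * ∑ m ∈ Ico 1 N, (1 : ℝ) / m) *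
            (B₂ * ∑ n ∈ Ico 1 N, ‖Skeleton.xiZero c' D j n d r‖ / n) := by
        refine (norm_sum_le _ _).trans (sum_le_sum fun d hd => ?_)
        refine (norm_sum_le _ _).trans (sum_le_sum fun r hr => ?_)
        have hd0 : d ≠ 0 := by have := (mem_Ico.mp hd).1; omega
        have hr0 : r ≠ 0 := by have := (mem_Ico.mp hr).1; omega
        exact norm_Sj_term_le_of_bounds c' D hd0 hr0 j N ha₁ ha₂
    _ ≤ ∑ d ∈ Ico 1 N, ∑ r ∈ Ico 1 N,
          (LamC d / d) * (((ArithmeticFunction.moebius r).natAbs : ℝ) * LamC r /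
              ((r : ℝ) * (Nat.totient r : ℝ))) * (B₁ * H) *
            (B₂ * (KX * (2 : ℝ) ^ r.primeFactors.card * ℓ ^ 9)) := by
        refine sum_le_sum fun d hd => sum_le_sum fun r hr => ?_
        have hd0 : d ≠ 0 := by have := (mem_Ico.mp hd).1; omega
        have hr0 : r ≠ 0 := by have := (mem_Ico.mp hr).1; omega
        have hw0 : 0 ≤ (LamC d / d) * (((ArithmeticFunction.moebius r).natAbs : ℝ) * LamC r /
            ((r : ℝ) * (Nat.totient r : ℝ))) :=
          mul_nonneg (div_nonneg (LamC_nonneg d) (Nat.cast_nonneg d))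
            (div_nonneg (mul_nonneg (Nat.cast_nonneg _) (LamC_nonneg r)) (by positivity))
        refine mul_le_mul (mul_le_mul_of_nonneg_left (mul_le_mul_of_nonneg_left hHm hB₁) hw0)
          (mul_le_mul_of_nonneg_left (hΞ hd0 hr0) hB₂)
          (mul_nonneg hB₂ (sum_nonneg fun n _ => div_nonneg (norm_nonneg _) (Nat.cast_nonneg n)))
          (mul_nonneg hw0 (mul_nonneg hB₁ hH0))
    _ = (B₁ * H) * (B₂ * (KX * ℓ ^ 9)) * ((∑ d ∈ Ico 1 N, LamC d / d) *
          ∑ r ∈ Ico 1 N, ((ArithmeticFunction.moebius r).natAbs : ℝ) * LamC r *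
            (2 : ℝ) ^ r.primeFactors.card / ((r : ℝ) * (Nat.totient r : ℝ))) := by
        rw [sum_mul_sum, mul_sum]
        refine sum_congr rfl fun d _ => ?_
        rw [mul_sum]
        refine sum_congr rfl fun r _ => ?_
        ring
    _ ≤ (B₁ * H) * (B₂ * (KX * ℓ ^ 9)) * ((EΛ * (2 * ℓ ^ 9)) * ER) := by
        have hs0 : 0 ≤ ∑ d ∈ Ico 1 N, LamC d / d :=
          sum_nonneg fun d _ => div_nonneg (LamC_nonneg d) (Nat.cast_nonneg d)
        refine mul_le_mul_of_nonneg_left (mul_le_mul hΛ hR ?_ (by positivity)) (by positivity)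
        exact sum_nonneg fun r _ => div_nonneg (mul_nonneg (mul_nonneg (Nat.cast_nonneg _)
          (LamC_nonneg r)) (by positivity)) (by positivity)
    _ = (4 * EH * EΛ * ER * KX) * B₁ * B₂ * ℓ ^ 27 := by rw [hH]; ring

end Literature.NumberTheory.LFunctions.Zhang2022.XiZeroMajorant

end
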